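import Summits.ValiantsHypothesis.ValiantsHypothesis.Theorems.DefinabilityGapPeelingRung
import HarnessLib

/-!
# DefinabilityGap — the peeling rung, SHARP form: the currency is the number of seed cells shared with the killed blocks

Route `route-ValiantsHypothesis-DefinabilityGap` (decomp-valiant cycle 1, lens 5). Census cells W5 / W19 (size road of
`KIPlantedHitting`, stmt-ValiantsHypothesis-23547) and F4 / W10 (`KIPlantedHittingRO`, stmt-ValiantsHypothesis-23704).

`DefinabilityGapPeelingRung` charged every block two zeros per peeling level (the worst case of the quadratic-curve design)
and so stopped at depth `⌊(m−2)/2⌋`. The zero-out induction needs the budget at exactly two places: the killed block at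
its kill time (to cancel `z_c^{min}`), and the blocks of the `≤ 2` final survivors (unique factorisation). Hence:

* `kiPerZ_hits_peel_sharp` / **`kiPer_hits_of_peel_sharp`** (`m ≥ 3`): `G_m` hits `D ≠ 0` as soon as some peeling
  sequence `l` leaves `≤ 2` monomials, each block of `l` shares `≤ m − 2` cells with the blocks killed before it
  (`KillBudget`), and each block of the final survivors shares `≤ m − 2` cells with the blocks of `l` — the LENGTH of `l`
  is now unbounded.
* `killBudget_of_pairwise_disjoint`: blocks with pairwise disjoint cell sets (e.g. a parallel class of curves
  `c + (t,0,0)`, up to `q` of them) have kill budget for free.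
* **`kiPer_hits_of_isolated_monomial`** / `kiPer_hits_monomial_add_sum_X_mul`: if one monomial `z^{κ₀}` of `D` is the
  only one avoiding all the variables `z_c`, `c ∈ l`, for a cell-disjoint family `l` of blocks whose cells avoid those of
  `κ₀`'s blocks, then `G_m` hits `D`: e.g. **`a·z^{κ₀} + Σ_{c ∈ l} z_c·E_c` for ARBITRARY polynomials `E_c` and ANY
  number of blocks `c`** — no size, degree, depth or support bound whatsoever; the only hypothesis is design geometry.

So the reach of zeroing is governed by the CELL-SHARING GRAPH of the blocks peeled versus the blocks of the last two
monomials, not by any size measure; its obstruction is a support whose every coordinate-minimal flag keeps `≥ 3` points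
unless it passes through blocks crowding `> m − 2` cells of one survivor. 0 sorry.
-/

noncomputable section

open MvPolynomial
open Literature.Computability.AlgebraicComplexity Literature.Computability.MetaComplexity

namespace Summit.ValiantsHypothesis.ValiantsHypothesis.Theorems.DefinabilityGapPeelingSharp

open Summit.ValiantsHypothesis.ValiantsHypothesis.Theorems.DefinabilityGapAffineRung
open Summit.ValiantsHypothesis.ValiantsHypothesis.Theorems.DefinabilityGapPatternPermanent
open Summit.ValiantsHypothesis.ValiantsHypothesis.Theorems.DefinabilityGapZeroedBlocks
open Summit.ValiantsHypothesis.ValiantsHypothesis.Theorems.DefinabilityGapSparsityRung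
open Summit.ValiantsHypothesis.ValiantsHypothesis.Theorems.DefinabilityGapPeelingRung

/-! ## 1. Parts along conjunctions; peeling when a monomial avoids the peeled variables -/

section Part

variable {σ : Type*} {R : Type*} [CommSemiring R]

/-- Iterated parts. [this file] -/
theorem part_part (D : MvPolynomial σ R) (p q : (σ →₀ ℕ) → Prop) [DecidablePred p] [DecidablePred q]
    [DecidablePred fun κ => p κ ∧ q κ] : part (part D p) q = part D (fun κ => p κ ∧ q κ) := by
  ext κ
  rw [coeff_part, coeff_part, coeff_part]
  by_cases hp : p κ <;> by_cases hq : q κ <;> simp [hp, hq]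

/-- A monomial with `z_c`-degree `0` forces `minExp = 0`. [this file] -/
theorem minExp_eq_zero {c : σ} {D : MvPolynomial σ R} {κ : σ →₀ ℕ} (hκ : κ ∈ D.support) (h0 : κ c = 0) :
    minExp c D = 0 := by
  have := minExp_le c hκ
  omega

/-- … and then the survivors are just the monomials avoiding `z_c`. [this file] -/
theorem survivors_eq_part {c : σ} {D : MvPolynomial σ R} {κ : σ →₀ ℕ} (hκ : κ ∈ D.support) (h0 : κ c = 0) :
    survivors c D = part D (fun κ => κ c = 0) := by
  rw [survivors, minExp_eq_zero hκ h0, Finsupp.single_zero, MvPolynomial.divMonomial_zero]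

/-- **If some monomial of `D` avoids every peeled variable, peeling along `l` keeps exactly the monomials avoiding them.**
[this file] -/
theorem peel_eq_part : ∀ (l : List σ) (D : MvPolynomial σ R) (κ₀ : σ →₀ ℕ), κ₀ ∈ D.support →
    (∀ c ∈ l, κ₀ c = 0) → peel l D = part D (fun κ => ∀ c ∈ l, κ c = 0) := by
  classical
  intro l
  induction l with
  | nil =>
    intro D κ₀ _ _
    rw [peel_nil]
    ext κ
    rw [coeff_part, if_pos fun c hc => (List.not_mem_nil hc).elim]
  | cons c l ih =>
    intro D κ₀ hκ₀ h0
    have hc0 : κ₀ c = 0 := h0 c (List.mem_cons_self)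
    rw [peel_cons, survivors_eq_part hκ₀ hc0]
    have hκ₀' : κ₀ ∈ (part D fun κ => κ c = 0).support := by
      rw [support_part, Finset.mem_filter]
      exact ⟨hκ₀, hc0⟩
    rw [ih _ κ₀ hκ₀' fun c' hc' => h0 c' (List.mem_cons_of_mem _ hc'), part_part]
    ext κ
    rw [coeff_part, coeff_part]
    by_cases h : ∀ x ∈ c :: l, κ x = 0
    · rw [if_pos h, if_pos (List.forall_mem_cons.1 h)]
    · rw [if_neg h, if_neg fun h' => h (List.forall_mem_cons.2 h')]

/-- … so the support of `peel l D` is the set of monomials of `D` avoiding every `z_c`, `c ∈ l`. [this file] -/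
theorem mem_support_peel_of_avoids (l : List σ) (D : MvPolynomial σ R) {κ₀ : σ →₀ ℕ} (hκ₀ : κ₀ ∈ D.support)
    (h0 : ∀ c ∈ l, κ₀ c = 0) (κ : σ →₀ ℕ) : κ ∈ (peel l D).support ↔ κ ∈ D.support ∧ ∀ c ∈ l, κ c = 0 := by
  classical
  rw [peel_eq_part l D κ₀ hκ₀ h0, support_part, Finset.mem_filter]

end Part

/-! ## 2. Cells of a peeling sequence; kill budgets -/

variable {m : ℕ}

/-- The cells of the blocks of a list. [this file] -/
def cellsOf (m : ℕ) : List (Fin 3 → Fin (qOf m)) → Finset (Fin (qOf m) × Fin (qOf m))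
  | [] => ∅
  | c :: l => cells m c ∪ cellsOf m l

/-- `cellsOf []`. [this file] -/
@[simp] theorem cellsOf_nil : cellsOf m [] = ∅ := rfl

/-- `cellsOf (c :: l)`. [this file] -/
@[simp] theorem cellsOf_cons (c : Fin 3 → Fin (qOf m)) (l : List (Fin 3 → Fin (qOf m))) :
    cellsOf m (c :: l) = cells m c ∪ cellsOf m l := rfl

/-- A set disjoint from the cells of each block of `l` is disjoint from `cellsOf l`. [this file] -/
theorem disjoint_cellsOf {s : Finset (Fin (qOf m) × Fin (qOf m))} :
    ∀ {l : List (Fin 3 → Fin (qOf m))}, (∀ c ∈ l, Disjoint s (cells m c)) → Disjoint s (cellsOf m l)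
  | [], _ => by rw [cellsOf_nil]; exact Finset.disjoint_empty_right _
  | c :: l, h => by
    rw [cellsOf_cons, Finset.disjoint_union_right]
    exact ⟨h c (List.mem_cons_self), disjoint_cellsOf fun c' hc' => h c' (List.mem_cons_of_mem _ hc')⟩

/-- A zero set disjoint from the cells of `c` cuts the empty pattern out of `c`. [this file] -/
theorem patOf_eq_empty_of_disjoint {F : Finset (Fin (qOf m) × Fin (qOf m))} {c : Fin 3 → Fin (qOf m)}
    (h : Disjoint (cells m c) F) : patOf m F c = ∅ := by
  ext rc
  simp only [mem_patOf, Finset.notMem_empty, iff_false]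
  exact fun hF => Finset.disjoint_left.1 h (Finset.mem_map_of_mem _ (Finset.mem_univ rc)) hF

/-- KILL BUDGET of a peeling sequence from the zero set `F`: each block, when its turn comes, has seen at most `m − 2`
zeros (those of `F` and of the cells of the blocks killed before it). [this file] -/
def KillBudget (m : ℕ) : Finset (Fin (qOf m) × Fin (qOf m)) → List (Fin 3 → Fin (qOf m)) → Prop
  | _, [] => True
  | F, c :: l => (patOf m F c).card + 2 ≤ m ∧ KillBudget m (F ∪ cells m c) l

/-- `KillBudget F []`. [this file] -/
theorem killBudget_nil (F : Finset (Fin (qOf m) × Fin (qOf m))) : KillBudget m F [] := trivial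

/-- `KillBudget F (c :: l)`. [this file] -/
theorem killBudget_cons {F : Finset (Fin (qOf m) × Fin (qOf m))} {c : Fin 3 → Fin (qOf m)}
    {l : List (Fin 3 → Fin (qOf m))} :
    KillBudget m F (c :: l) ↔ (patOf m F c).card + 2 ≤ m ∧ KillBudget m (F ∪ cells m c) l :=
  Iff.rfl

/-- **Cell-disjoint families peel for free**: blocks with pairwise disjoint cell sets, disjoint from `F`, have kill budget
from `F`, WHATEVER THEIR NUMBER (`m ≥ 2`). [this file] -/
theorem killBudget_of_pairwise_disjoint (hm : 2 ≤ m) :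
    ∀ (l : List (Fin 3 → Fin (qOf m))) (F : Finset (Fin (qOf m) × Fin (qOf m))),
      (∀ c ∈ l, Disjoint (cells m c) F) → l.Pairwise (fun c c' => Disjoint (cells m c) (cells m c')) →
      KillBudget m F l := by
  intro l
  induction l with
  | nil => intros; trivial
  | cons c l ih =>
    intro F hF hpw
    rw [List.pairwise_cons] at hpw
    refine ⟨?_, ih (F ∪ cells m c) (fun c' hc' => ?_) hpw.2⟩
    · rw [patOf_eq_empty_of_disjoint (hF c (List.mem_cons_self)), Finset.card_empty]
      omega
    · rw [Finset.disjoint_union_right]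
      exact ⟨hF c' (List.mem_cons_of_mem _ hc'), (hpw.1 c' hc').symm⟩

/-! ## 3. The sharp peeling theorem -/

/-- **Zero-out induction, sharp budget.** For `m ≥ 3`: if `peel l D` has at most two monomials, `l` has kill budget from
`F`, every block of the final survivors has seen at most `m − 2` zeros of `F ∪ cellsOf l`, and `D(Q^F) = 0`, then `D = 0`.
[this file] -/
theorem kiPerZ_hits_peel_sharp (hm : 3 ≤ m) :
    ∀ (l : List (Fin 3 → Fin (qOf m))) (F : Finset (Fin (qOf m) × Fin (qOf m)))
      (D : MvPolynomial (Fin 3 → Fin (qOf m)) ℂ),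
      (peel l D).support.card ≤ 2 → KillBudget m F l →
      (∀ κ ∈ (peel l D).support, ∀ c' ∈ κ.support, (patOf m (F ∪ cellsOf m l) c').card + 2 ≤ m) →
      bind₁ (kiPerZ m F) D = 0 → D = 0 := by
  classical
  intro l
  induction l with
  | nil =>
    intro F D h2 _ hb h0
    have hs : D.support.card ≤ 2 := h2
    refine kiPerZ_hits_sparse hm D.support.card F D rfl (fun κ hκ c hc => ?_) h0
    have := hb κ hκ c hc
    rw [cellsOf_nil, Finset.union_empty] at this
    omega
  | cons c l ih =>
    intro F D h2 hkb hb h0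
    by_contra hD
    rw [killBudget_cons] at hkb
    have hsurv := bind₁_kiPerZ_survivors hm c (fun _ _ _ => hkb.1) h0
    rw [peel_cons] at h2 hb
    refine survivors_ne_zero c hD (ih (F ∪ cells m c) (survivors c D) h2 hkb.2 (fun κ hκ c' hc' => ?_) hsurv)
    have := hb κ hκ c' hc'
    rwa [cellsOf_cons, ← Finset.union_assoc] at this

/-- **SHARP PEELING RUNG for `G_m`** (`m ≥ 3`, `D ≠ 0`): a peeling sequence of ANY length leaving `≤ 2` monomials, with
kill budget, whose cells crowd no block of the final survivors, certifies `D(G_m) ≠ 0`. [this file] -/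
theorem kiPer_hits_of_peel_sharp (hm : 3 ≤ m) {D : MvPolynomial (Fin 3 → Fin (qOf m)) ℂ} (hD : D ≠ 0)
    (l : List (Fin 3 → Fin (qOf m))) (hl : (peel l D).support.card ≤ 2) (hkill : KillBudget m ∅ l)
    (hfinal : ∀ κ ∈ (peel l D).support, ∀ c' ∈ κ.support, (patOf m (cellsOf m l) c').card + 2 ≤ m) :
    bind₁ (kiPer m) D ≠ 0 := by
  intro h0
  apply hD
  refine kiPerZ_hits_peel_sharp hm l ∅ D hl hkill
    (fun κ hκ c' hc' => by rw [Finset.empty_union]; exact hfinal κ hκ c' hc') ?_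
  have : kiPerZ m ∅ = kiPer m := funext kiPerZ_empty
  rw [this]
  exact h0

/-! ## 4. Isolated monomials -/

/-- **Isolated monomial.** For `m ≥ 3`: if `z^{κ₀}` is the only monomial of `D` avoiding all `z_c`, `c ∈ l`, the blocks of
`l` have kill budget, and every block of `κ₀` shares `≤ m − 2` cells with the blocks of `l`, then `G_m` hits `D` — all
other monomials of `D` are arbitrary. [this file] -/
theorem kiPer_hits_of_isolated_monomial (hm : 3 ≤ m) {D : MvPolynomial (Fin 3 → Fin (qOf m)) ℂ}
    (l : List (Fin 3 → Fin (qOf m))) {κ₀ : (Fin 3 → Fin (qOf m)) →₀ ℕ} (hκ₀ : κ₀ ∈ D.support)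
    (h0 : ∀ c ∈ l, κ₀ c = 0) (huniq : ∀ κ ∈ D.support, (∀ c ∈ l, κ c = 0) → κ = κ₀) (hkill : KillBudget m ∅ l)
    (hfinal : ∀ c' ∈ κ₀.support, (patOf m (cellsOf m l) c').card + 2 ≤ m) : bind₁ (kiPer m) D ≠ 0 := by
  classical
  have hD : D ≠ 0 := fun h => by
    rw [h, support_zero] at hκ₀
    exact Finset.notMem_empty _ hκ₀
  have hsupp : (peel l D).support ⊆ {κ₀} := by
    intro κ hκ
    rw [mem_support_peel_of_avoids l D hκ₀ h0] at hκ
    exact Finset.mem_singleton.2 (huniq κ hκ.1 hκ.2)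
  refine kiPer_hits_of_peel_sharp hm hD l ((Finset.card_le_card hsupp).trans (by simp)) hkill
    fun κ hκ c' hc' => ?_
  rw [Finset.mem_singleton.1 (hsupp hκ)] at hc'
  exact hfinal c' hc'

/-- **Isolated monomial, geometric form.** For `m ≥ 3`: `l` a family of blocks with pairwise disjoint cell sets, `z^{κ₀}` the
only monomial of `D` avoiding all `z_c` (`c ∈ l`), and the cells of the blocks of `κ₀` disjoint from those of `l`: then
`G_m` hits `D`. [this file] -/
theorem kiPer_hits_of_isolated_monomial_disjoint (hm : 3 ≤ m) {D : MvPolynomial (Fin 3 → Fin (qOf m)) ℂ}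
    (l : List (Fin 3 → Fin (qOf m))) (hpw : l.Pairwise (fun c c' => Disjoint (cells m c) (cells m c')))
    {κ₀ : (Fin 3 → Fin (qOf m)) →₀ ℕ} (hκ₀ : κ₀ ∈ D.support) (h0 : ∀ c ∈ l, κ₀ c = 0)
    (huniq : ∀ κ ∈ D.support, (∀ c ∈ l, κ c = 0) → κ = κ₀)
    (hfar : ∀ c' ∈ κ₀.support, ∀ c ∈ l, Disjoint (cells m c') (cells m c)) : bind₁ (kiPer m) D ≠ 0 := by
  refine kiPer_hits_of_isolated_monomial hm l hκ₀ h0 huniq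
    (killBudget_of_pairwise_disjoint (by omega) l ∅ (fun c _ => Finset.disjoint_empty_right _) hpw)
    fun c' hc' => ?_
  rw [patOf_eq_empty_of_disjoint (disjoint_cellsOf (hfar c' hc')), Finset.card_empty]
  omega

/-- **`a·z^{κ₀} + Σ_{c ∈ l} z_c·E_c` is hit, for ARBITRARY `E_c` and ANY number of cell-disjoint blocks `c`** away from the
blocks of `κ₀` (`m ≥ 3`, `a ≠ 0`, `z_c ∤ z^{κ₀}`). [this file] -/
theorem kiPer_hits_monomial_add_sum_X_mul (hm : 3 ≤ m) (l : List (Fin 3 → Fin (qOf m)))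
    (hpw : l.Pairwise (fun c c' => Disjoint (cells m c) (cells m c'))) (κ₀ : (Fin 3 → Fin (qOf m)) →₀ ℕ)
    (h0 : ∀ c ∈ l, κ₀ c = 0) (hfar : ∀ c' ∈ κ₀.support, ∀ c ∈ l, Disjoint (cells m c') (cells m c))
    {a : ℂ} (ha : a ≠ 0) (E : (Fin 3 → Fin (qOf m)) → MvPolynomial (Fin 3 → Fin (qOf m)) ℂ) :
    bind₁ (kiPer m) (monomial κ₀ a + ∑ c ∈ l.toFinset, X c * E c) ≠ 0 := by
  classical
  -- the coefficients of the monomials avoiding every `z_c`, `c ∈ l`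
  have hcoeff : ∀ κ : (Fin 3 → Fin (qOf m)) →₀ ℕ, (∀ c ∈ l, κ c = 0) →
      coeff κ (monomial κ₀ a + ∑ c ∈ l.toFinset, X c * E c) = if κ₀ = κ then a else 0 := by
    intro κ hκ
    rw [coeff_add, coeff_monomial, coeff_sum, Finset.sum_eq_zero fun c hc => ?_, add_zero]
    have hc' : c ∉ κ.support := by
      rw [Finsupp.mem_support_iff, not_not]
      exact hκ c (List.mem_toFinset.1 hc)
    rw [coeff_X_mul', if_neg hc']
  have hκ₀ : κ₀ ∈ (monomial κ₀ a + ∑ c ∈ l.toFinset, X c * E c).support := by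
    rw [mem_support_iff, hcoeff κ₀ h0, if_pos rfl]
    exact ha
  refine kiPer_hits_of_isolated_monomial_disjoint hm l hpw hκ₀ h0 (fun κ hκ hκl => ?_) hfar
  rw [mem_support_iff, hcoeff κ hκl] at hκ
  by_contra hne
  exact hκ (if_neg (Ne.symm hne))

end Summit.ValiantsHypothesis.ValiantsHypothesis.Theorems.DefinabilityGapPeelingSharp
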